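import Mathlib.AlgebraicGeometry.Morphisms.QuasiFinite
import Literature.AlgebraicGeometry.Motives.AbelianVarietyChartFamily
import Literature.AlgebraicGeometry.Motives.PureCodimOneDivisor
import Literature.AlgebraicGeometry.Motives.AffineSpaceFactorial
import Literature.AlgebraicGeometry.Motives.AffineSpaceDivisor
import Literature.AlgebraicGeometry.Motives.CartierDivisorOfComplementProofs
import HarnessLib

/-!
# The family of translates of a divisor along a finite flat chart of an abelian variety, II:
# the swept-out divisor on `𝔸ˢ_A` (purity of the incidence locus)

Continuation of `Motives/AbelianVarietyChartFamily` (Görtz–Wedhorn II, Thm. 27.71, Step (IV):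
"Let `𝓔 ⊆ G ×_S X` be the preimage of `E` under the action morphism `a` … an effective Cartier
divisor because `a` is flat … `𝓜 := N_{π⁻¹(V)/V}(𝓝|V×X)`"). For an abelian variety `A` over an
algebraically closed field, a finite flat chart `c` (`W →π D(h)`) and an effective Cartier divisor
`E` on `A`, we construct an effective Cartier divisor `𝓓` on `P = 𝔸ˢ_A` whose support is the
closure `Z` of `ρ(Supp 𝓔)`, `𝓔 = act^* E` on `WA = W ×_{𝔸ˢ} 𝔸ˢ_A` — instead of the norm of the
printed proof we use that `P` is locally factorial and that `Z` is pure of codimension one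
(`Motives/PureCodimOneDivisor`):

* `ChartFamily.eq_genericPoint_of_isFinite` — a finite morphism of integral schemes maps only
  the generic point to the generic point (incomparability, Mathlib `Ideal.eq_bot_of_comap_eq_bot`);
* `ChartFamily.suppSet`, `ChartFamily.Z`, `ChartFamily.genericPoint_notMem_Z`;
* `ChartFamily.height_eq_one_of_mem_minimalPrimes` — **purity of `Z`**: a minimal prime of the
  ideal of `Z` on an affine chart `V` of `P` has height one. Its point `ζ` is a maximal point of
  `Z`, hence `ζ = ρ ζ'` for a maximal point `ζ'` of `Supp 𝓔` (noetherian decomposition, generic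
  points, finite fibres of `ρ₁`); `ht 𝔭_{ζ'} = 1` (the support of an effective Cartier divisor
  is locally a hypersurface: Krull's principal ideal theorem); `ht 𝔭_ζ ≤ ht 𝔭_{ζ'}` by flatness
  of `ρ` (going down, Mathlib `Ideal.height_eq_height_add_of_liesOver_of_hasGoingDown`) and
  `𝔭_ζ ≠ 0` as the generic point of `P` is not in `Z`;
* `ChartFamily.exists_sweptDivisor` — **the effective Cartier divisor `𝓓` on `𝔸ˢ_A` with
  `Supp 𝓓 = Z`** (local rings of `𝔸ˢ_A` factorial: `Motives/AffineSpaceFactorial` with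
  Auslander–Buchsbaum for the regular local rings of `A`).

Everything is proved; no named facts.

## References

* U. Görtz, T. Wedhorn, *Algebraic Geometry II: Cohomology of Schemes*, Springer Spektrum (2023),
  doi:10.1007/978-3-658-43031-3: Thm. 27.71, proof, Step (IV), p. 829; Lemma 25.150 (p. 670).
  [GortzWedhorn2023]
* The Stacks project, Tag 0BF7. [StacksProject]
-/

universe u

open CategoryTheory CategoryTheory.Limits AlgebraicGeometry TopologicalSpace Opposite
open Literature.AlgebraicGeometry.Motives.RatFn
open scoped MonObj

noncomputable section

namespace Literature.AlgebraicGeometry.Motives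

-- Mathlib's algebraic-geometry files need this for `Γ(X, V)`-algebra structures on stalks
-- (`TopCat.Presheaf` versus functor types under instance transparency); cf. `AffineScheme.lean`.
set_option backward.isDefEq.respectTransparency false

namespace ChartFamily

/-! ### Generalities: finite morphisms and generic points; specialisation on affine charts -/

section General

variable {X Y : Scheme.{u}}

/-- **A finite morphism of integral schemes maps only the generic point to the generic point**
(on an affine chart `V ∋ η_X`: `Γ(Y, f⁻¹V)` is integral over `Γ(X, V)` and the prime of `y` lies
over `(0)`, hence is `(0)`; Mathlib `Ideal.eq_bot_of_comap_eq_bot`). [folklore] -/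
theorem eq_genericPoint_of_isFinite [IsIntegral X] [IsIntegral Y] (f : Y ⟶ X) [IsFinite f]
    {y : Y} (hy : f y = genericPoint X) : y = genericPoint Y := by
  obtain ⟨V', hV', hyV', -⟩ := exists_isAffineOpen_mem_and_subset
    (show f y ∈ (⊤ : X.Opens) from trivial)
  have hV : IsAffineOpen V' := hV'
  -- the affine chart `f⁻¹ V` and the integral ring map
  have hint₀ := (HasAffineProperty.eq_targetAffineLocally (P := @IsIntegralHom)).le f inferInstance
  have hint : targetAffineLocally (affineAnd RingHom.IsIntegral) f := hint₀
  rw [targetAffineLocally_affineAnd_iff RingHom.isIntegral_respectsIso] at hint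
  obtain ⟨hW, hI⟩ := hint V' hV
  haveI : Nonempty (f ⁻¹ᵁ V' : Y.Opens) := ⟨⟨y, hyV'⟩⟩
  haveI : Nonempty (V' : X.Opens) := ⟨⟨_, hyV'⟩⟩
  letI : Algebra Γ(X, V') Γ(Y, f ⁻¹ᵁ V') := (f.app V').hom.toAlgebra
  haveI : Algebra.IsIntegral Γ(X, V') Γ(Y, f ⁻¹ᵁ V') := ⟨hI⟩
  -- the prime of `y` lies over `(0)`
  have hcomap : (hW.primeIdealOf ⟨y, hyV'⟩).asIdeal.comap (algebraMap Γ(X, V') Γ(Y, f ⁻¹ᵁ V')) = ⊥ := by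
    have h1 := IsAffineOpen.comap_primeIdealOf_appLE V' hV (f ⁻¹ᵁ V') hW le_rfl hyV'
    rw [← Scheme.Hom.app_eq_appLE] at h1
    have h2 : hV.primeIdealOf ⟨f y, hyV'⟩ = ⊥ := by
      have h3 := hV.primeIdealOf_genericPoint
      rw [genericPoint_eq_bot_of_affine] at h3
      convert h3
    have := congrArg PrimeSpectrum.asIdeal (h1.trans h2)
    exact this
  have hbot : (hW.primeIdealOf ⟨y, hyV'⟩).asIdeal = ⊥ := Ideal.eq_bot_of_comap_eq_bot hcomap
  -- hence `y` is the generic point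
  have h4 := hW.primeIdealOf_genericPoint
  rw [genericPoint_eq_bot_of_affine] at h4
  have h5 : hW.primeIdealOf ⟨y, hyV'⟩ = hW.primeIdealOf ⟨genericPoint Y, _⟩ :=
    (PrimeSpectrum.ext hbot).trans h4.symm
  have := congrArg hW.fromSpec h5
  rwa [hW.fromSpec_primeIdealOf, hW.fromSpec_primeIdealOf] at this

/-- On an affine chart, `y ⤳ z` iff `𝔭_y ⊆ 𝔭_z`. [folklore] -/
theorem primeIdealOf_le_iff_specializes {V : X.Opens} (hV : IsAffineOpen V) (y z : V) :
    hV.primeIdealOf y ≤ hV.primeIdealOf z ↔ (y : X) ⤳ (z : X) := by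
  rw [PrimeSpectrum.le_iff_specializes]
  have h := hV.fromSpec.isOpenEmbedding.isInducing.specializes_iff
    (x := hV.primeIdealOf y) (y := hV.primeIdealOf z)
  erw [hV.fromSpec_primeIdealOf, hV.fromSpec_primeIdealOf] at h
  exact h.symm

end General

/-! ### The incidence divisor `𝓔 = act^* E` and the swept-out locus `Z` -/

variable {k : Type u} [Field k] [IsAlgClosed k] (A : AbelianVariety k)
  (c : FiniteFlatChart k A.X.left A.X.hom)

/-- `W` has a rational point (a closed point of the non-empty open `W` of the Jacobson `A`,
rational as `k` is algebraically closed). [folklore] -/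
theorem exists_point_mem_W : ∃ Q : A.Points k, AlgPoints.pt Q ∈ c.W := by
  obtain ⟨g, hgc, hgW⟩ := A.exists_isClosed_mem_of_isOpen c.W.2
    (Set.nonempty_coe_sort.1 c.nonempty_W)
  exact ⟨A.pointOfClosed g hgc, by rwa [A.pt_pointOfClosed]⟩

/-- The action morphism on underlying schemes, `WA → A` (source syntactically `WA`). [folklore] -/
abbrev actL : WA A c ⟶ A.X.left := (act A c).left

/-- **The action morphism is surjective** (its restriction to a slice `{g} × A` is the
translation `t_g`, an automorphism). [folklore] -/
instance surjective_actL : Surjective (actL A c) := by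
  obtain ⟨Q, hQ⟩ := exists_point_mem_W A c
  refine ⟨fun y => ?_⟩
  refine ⟨sectionAt Q hQ (inv (A.translation Q).left y), ?_⟩
  change ((inv (A.translation Q).left ≫ sectionAt Q hQ) ≫ (act A c).left) y = y
  rw [Category.assoc, sectionAt_act, IsIso.inv_hom_id]
  rfl

/-- The action morphism is dominant. [folklore] -/
instance isDominant_actL : IsDominant (actL A c) := inferInstance

variable (E : CartierDivisor A.X.left)

/-- **`𝓔 = act^* E`**, the incidence divisor on `WA`. [folklore] -/
abbrev incidence : CartierDivisor (WA A c) := E.pullback (actL A c)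

/-- The support `Supp 𝓔 ⊆ WA`. [folklore] -/
def suppSet : Set (WA A c) := {w | ¬ (incidence A c E).Avoids w}

/-- **`Z`, the closure in `P = 𝔸ˢ_A` of `ρ(Supp 𝓔)`.** [folklore] -/
def Z : Set (P A c) := closure (ρ A c '' suppSet A c E)

/-- `Z` is closed. [folklore] -/
theorem isClosed_Z : IsClosed (Z A c E) := isClosed_closure

/-- `Supp 𝓔` is closed. [folklore] -/
theorem isClosed_suppSet : IsClosed (suppSet A c E) := by
  rw [suppSet, ← isOpen_compl_iff]
  convert AffineSpaceDivisor.isOpen_setOf_avoids (incidence A c E) using 1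
  ext w; simp

/-- `ρ(Supp 𝓔) = jA (ρ₁ (Supp 𝓔))` and `ρ₁(Supp 𝓔)` is closed in `P_V` (`ρ₁` is finite). [folklore] -/
theorem isClosed_image_ρ₁ : IsClosed (ρ₁ A c '' suppSet A c E) :=
  (ρ₁ A c).isClosedMap _ (isClosed_suppSet A c E)

/-- `ρ(Supp 𝓔) = jA (ρ₁ (Supp 𝓔))`. [folklore] -/
theorem image_ρ_eq : ρ A c '' suppSet A c E = jA A c '' (ρ₁ A c '' suppSet A c E) := by
  rw [Set.image_image]; congr 1; ext w
  change _ = (ρ₁ A c ≫ jA A c) w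
  rw [ρ₁_jA]

/-- `Z ∩ jA(P_V) = ρ(Supp 𝓔)`: the trace of the closure on the open part is the closed image
(`jA` is an open embedding and `ρ₁(Supp 𝓔)` is closed in `P_V`). [folklore] -/
theorem Z_inter_range_jA : Z A c E ∩ Set.range (jA A c) = ρ A c '' suppSet A c E := by
  rw [Z, image_ρ_eq]
  ext p
  constructor
  · rintro ⟨hp, q, rfl⟩
    by_contra hq
    have hq' : q ∉ ρ₁ A c '' suppSet A c E := fun h => hq ⟨q, h, rfl⟩
    -- the open `jA (P_V ∖ ρ₁(Supp 𝓔)) ∋ jA q` misses `jA(ρ₁(Supp 𝓔))`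
    have hopen : IsOpen (jA A c '' (ρ₁ A c '' suppSet A c E)ᶜ) :=
      (jA A c).isOpenEmbedding.isOpenMap _ (isClosed_image_ρ₁ A c E).isOpen_compl
    rw [mem_closure_iff] at hp
    obtain ⟨p', ⟨q', hq'mem, rfl⟩, ⟨q'', hq''mem, e⟩⟩ := hp _ hopen ⟨q, hq', rfl⟩
    exact hq'mem (((jA A c).isOpenEmbedding.injective e) ▸ hq''mem)
  · rintro ⟨q, hq, rfl⟩
    exact ⟨subset_closure ⟨q, hq, rfl⟩, q, rfl⟩

/-! ### The generic point of `P` is not swept out -/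

/-- `P_V` is non-empty. [folklore] -/
instance nonempty_PV : Nonempty (PV A c) := ⟨ρ₁ A c (genericPoint (WA A c))⟩

/-- `P_V` is integral (a non-empty open subscheme of the integral `P`). [folklore] -/
instance isIntegral_PV : IsIntegral (PV A c) := isIntegral_of_isOpenImmersion (jA A c)

omit [IsAlgClosed k] in
/-- `jA` maps the generic point to the generic point. [folklore] -/
theorem jA_genericPoint : jA A c (genericPoint (PV A c)) = genericPoint (P A c) := by
  apply genericPoint_eq_of_isOpenImmersion

omit [IsAlgClosed k] in
/-- The generic point of `P` lies in `jA(P_V)`. [folklore] -/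
theorem genericPoint_mem_range_jA : genericPoint (P A c) ∈ Set.range (jA A c) :=
  ⟨_, jA_genericPoint A c⟩

omit [IsAlgClosed k] in
/-- **`ρ w = η_P` only for `w = η_{WA}`** (`ρ = ρ₁ ≫ jA`, `ρ₁` finite). [folklore] -/
theorem eq_genericPoint_of_ρ_eq {w : WA A c} (hw : ρ A c w = genericPoint (P A c)) :
    w = genericPoint (WA A c) := by
  apply eq_genericPoint_of_isFinite (ρ₁ A c)
  apply (jA A c).isOpenEmbedding.injective
  rw [jA_genericPoint, ← hw, ← Scheme.Hom.comp_apply, ρ₁_jA]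

/-- **The generic point of `P` is not in `Z`.** [folklore] -/
theorem genericPoint_notMem_Z : genericPoint (P A c) ∉ Z A c E := by
  intro h
  have h' : genericPoint (P A c) ∈ Z A c E ∩ Set.range (jA A c) := ⟨h, genericPoint_mem_range_jA A c⟩
  rw [Z_inter_range_jA] at h'
  obtain ⟨w, hw, hwη⟩ := h'
  have := eq_genericPoint_of_ρ_eq A c hwη
  subst this
  apply hw
  intro i _
  exact isUnitAt_genericPoint ((incidence A c E).f_ne_zero i)

/-- The open complement `P ∖ Z`. [folklore] -/
def Uo : (P A c).Opens := ⟨(Z A c E)ᶜ, (isClosed_Z A c E).isOpen_compl⟩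

/-- Membership in the closed complement of `Uo` is membership in `Z`. [folklore] -/
theorem mem_Uo_compl_iff (p : P A c) : p ∈ (Uo A c E).compl ↔ p ∈ Z A c E := by
  change p ∈ (Z A c E)ᶜᶜ ↔ _
  rw [compl_compl]

/-- `P ∖ Z` is non-empty (it contains the generic point). [folklore] -/
instance nonempty_Uo : Nonempty (Uo A c E) := ⟨⟨genericPoint (P A c), genericPoint_notMem_Z A c E⟩⟩

/-! ### The support of an effective Cartier divisor is a hypersurface at its maximal points -/

section Hypersurface

variable {Y : Scheme.{u}} [IsIntegral Y] [IsLocallyNoetherian Y] (D : CartierDivisor Y)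

/-- **At a maximal point `w` of `Supp D` (`D` effective) the local ring is one-dimensional**:
near `w` a local equation is a section `a'` with `Supp D = V(a')`, so `𝔭_w` is a minimal prime
over `(a')`, of height `≤ 1` by Krull's principal ideal theorem, and `≠ 0`. [folklore] -/
theorem ringKrullDim_stalk_eq_one_of_maximal (hD : D.IsEffective) {w : Y} (hw : ¬ D.Avoids w)
    (hmax : ∀ w', ¬ D.Avoids w' → w' ⤳ w → w' = w) :
    ringKrullDim (Y.presheaf.stalk w) = 1 := by
  classical
  obtain ⟨i, hi⟩ := D.covers w
  -- an affine neighbourhood inside the chart, and `e = a / b` there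
  obtain ⟨V₁, hV₁, hwV₁, hV₁U⟩ := exists_isAffineOpen_mem_and_subset hi
  haveI : Nonempty V₁ := ⟨⟨w, hwV₁⟩⟩
  obtain ⟨a, b, hb, hab⟩ := (isRegularAt_iff_exists hV₁ ⟨w, hwV₁⟩ (D.f i)).1 (hD i w hi)
  -- shrink to `V₂ = D(b)` where `e` is the section `a' = a b⁻¹`
  have hV₂ : IsAffineOpen (Y.basicOpen b) := hV₁.basicOpen b
  have hV₂V₁ : Y.basicOpen b ≤ V₁ := Y.basicOpen_le b
  have hbunit : ∀ y : V₁, (y : Y) ∈ Y.basicOpen b ↔ b ∉ (hV₁.primeIdealOf y).asIdeal := fun y => by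
    rw [← isUnitAt_algebraMap_iff hV₁ y b, ← toFunctionField_algebraMap_stalk y,
      algebraMap_stalk_eq_germ, isUnitAt_germ_iff]
  have hwV₂ : w ∈ Y.basicOpen b := (hbunit ⟨w, hwV₁⟩).2 hb
  -- replace `w` by a point of the subtype `V₂` (instance keys of the stalk algebra)
  obtain ⟨w, rfl⟩ : ∃ w' : (Y.basicOpen b : Y.Opens), (w' : Y) = w := ⟨⟨w, hwV₂⟩, rfl⟩
  haveI : Nonempty (Y.basicOpen b : Y.Opens) := ⟨w⟩
  have hbu : IsUnit (Y.presheaf.map (homOfLE hV₂V₁).op b) :=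
    RingedSpace.isUnit_res_basicOpen (X := Y.toLocallyRingedSpace.toRingedSpace) b
  obtain ⟨u, hu⟩ := hbu
  set a' : Γ(Y, Y.basicOpen b) := Y.presheaf.map (homOfLE hV₂V₁).op a * ↑u⁻¹ with ha'
  have hea' : algebraMap Γ(Y, Y.basicOpen b) Y.functionField a' = D.f i := by
    have h1 : algebraMap Γ(Y, Y.basicOpen b) Y.functionField (↑u : Γ(Y, Y.basicOpen b)) =
        algebraMap Γ(Y, V₁) Y.functionField b := by
      rw [hu]; exact algebraMap_map hV₂V₁ b
    rw [ha', map_mul, algebraMap_map hV₂V₁ a, ← hab, mul_assoc]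
    conv_rhs => rw [← mul_one (D.f i)]
    congr 1
    rw [← h1, ← map_mul, Units.mul_inv, map_one]
  -- on `V₂`: `Supp D = V(a')`
  have hsupp : ∀ y : (Y.basicOpen b : Y.Opens),
      ¬ D.Avoids y ↔ a' ∈ (hV₂.primeIdealOf y).asIdeal := by
    intro y
    have hyi : (y : Y) ∈ D.U i := hV₁U (hV₂V₁ y.2)
    rw [← not_iff_not, not_not, ← isUnitAt_algebraMap_iff hV₂ y a', hea']
    exact ⟨fun h => h i hyi, fun h => CartierDivisor.Avoids.of_mem hyi h⟩
  -- `𝔭_w` is a minimal prime over `(a')`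
  set 𝔭 := (hV₂.primeIdealOf w).asIdeal with h𝔭
  have ha'𝔭 : a' ∈ 𝔭 := (hsupp w).1 hw
  have hmin : 𝔭 ∈ (Ideal.span {a'}).minimalPrimes := by
    refine ⟨⟨inferInstance, (Ideal.span_singleton_le_iff_mem _).2 ha'𝔭⟩, ?_⟩
    rintro Q ⟨hQ, hQa⟩ hQ𝔭
    -- the point of `Q`
    let y : (Y.basicOpen b : Y.Opens) := ⟨hV₂.fromSpec ⟨Q, hQ⟩, FieldNorm.fromSpec_mem hV₂ _⟩
    have hyQ : hV₂.primeIdealOf y = ⟨Q, hQ⟩ := FieldNorm.primeIdealOf_fromSpec hV₂ _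
    have hyS : ¬ D.Avoids y :=
      (hsupp y).2 (by rw [hyQ]; exact (Ideal.span_singleton_le_iff_mem _).1 hQa)
    have hyw : (y : Y) ⤳ w := by
      rw [← primeIdealOf_le_iff_specializes hV₂ y w, hyQ]
      exact hQ𝔭
    have := hmax y hyS hyw
    have h2 : hV₂.primeIdealOf y = hV₂.primeIdealOf w := by rw [Subtype.ext this]
    rw [h𝔭, ← h2, hyQ]
  -- Krull: `ht 𝔭 ≤ 1`, and `𝔭 ≠ 0`
  haveI : IsNoetherianRing Γ(Y, Y.basicOpen b) := IsLocallyNoetherian.component_noetherian ⟨_, hV₂⟩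
  have hle : 𝔭.height ≤ 1 := Ideal.height_le_one_of_isPrincipal_of_mem_minimalPrimes _ _ hmin
  have ha'0 : a' ≠ 0 := by
    intro h0
    apply D.f_ne_zero i
    rw [← hea', h0, map_zero]
  have hne : 𝔭.height ≠ 0 := by
    intro h0
    rw [Ideal.height_eq_zero_iff] at h0
    have hbot : 𝔭 = ⊥ := le_bot_iff.1 (h0.2 ⟨Ideal.isPrime_bot, bot_le⟩ bot_le)
    exact ha'0 (by simpa [hbot] using ha'𝔭)
  have h1 : 𝔭.height = 1 := le_antisymm hle (Order.one_le_iff_ne_zero.2 hne)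
  haveI := hV₂.isLocalization_stalk w
  rw [IsLocalization.AtPrime.ringKrullDim_eq_height 𝔭 (Y.presheaf.stalk w), h1]
  rfl

end Hypersurface

/-! ### Purity of `Z` -/

omit [IsAlgClosed k] in
/-- `ρ` is locally of finite type (a base change of `toAffine`). [folklore] -/
instance locallyOfFiniteType_ρ : LocallyOfFiniteType (ρ A c) := by
  haveI := c.isFinite_π
  haveI : LocallyOfFiniteType (toAffine A c) := by unfold toAffine; infer_instance
  infer_instance

/-- `P` is locally noetherian. [folklore] -/
instance isLocallyNoetherian_P : IsLocallyNoetherian (P A c) := by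
  haveI := A.isNoetherian_left
  exact isLocallyNoetherian_affineSpace _

/-- `WA` is locally noetherian. [folklore] -/
instance isLocallyNoetherian_WA : IsLocallyNoetherian (WA A c) :=
  LocallyOfFiniteType.isLocallyNoetherian (ρ A c)

/-- `jS` is quasi-compact (a morphism of affine schemes). [folklore] -/
instance quasiCompact_jS : QuasiCompact (jS A c) := by
  haveI : IsAffineHom (jS A c) := by unfold jS; infer_instance
  infer_instance

/-- `WA` is quasi-compact. [folklore] -/
instance compactSpace_WA : CompactSpace (WA A c) := by
  haveI := c.isFinite_π
  haveI : QuasiCompact (toAffine A c) := by unfold toAffine; infer_instance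
  haveI : QuasiCompact (ρ A c) := inferInstance
  haveI : CompactSpace (P A c) := inferInstance
  exact QuasiCompact.compactSpace_of_compactSpace (ρ A c)

/-- `WA` is noetherian. [folklore] -/
instance isNoetherian_WA : IsNoetherian (WA A c) := {}

/-- **A maximal point `ζ` of `Z` is swept out: `ζ = ρ w` with `w ∈ Supp 𝓔`** (decompose the
closed `Supp 𝓔` of the noetherian `WA` into irreducible closed pieces; `Z` is the union of the
closures of their images, whose generic points are images of generic points). [folklore] -/
theorem exists_mem_suppSet_of_maximal {ζ : P A c} (hζ : ζ ∈ Z A c E)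
    (hmax : ∀ z' ∈ Z A c E, z' ⤳ ζ → z' = ζ) : ∃ w ∈ suppSet A c E, ρ A c w = ζ := by
  obtain ⟨𝒮, h𝒮fin, h𝒮cl, h𝒮irr, h𝒮eq⟩ :=
    NoetherianSpace.exists_finite_set_isClosed_irreducible (isClosed_suppSet A c E)
  have hZ : Z A c E = ⋃ t ∈ 𝒮, closure (ρ A c '' t) := by
    rw [Z, h𝒮eq, Set.image_sUnion, ← h𝒮fin.closure_biUnion, Set.sUnion_image]
  have hζ' := hζ
  rw [hZ, Set.mem_iUnion₂] at hζ'
  obtain ⟨t, ht, hζt⟩ := hζ'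
  obtain ⟨γ, hγ⟩ := QuasiSober.sober (h𝒮irr t ht) (h𝒮cl t ht)
  have hγt : γ ∈ t := hγ.mem
  have hγS : γ ∈ suppSet A c E := by rw [h𝒮eq]; exact ⟨t, ht, hγt⟩
  have himg := hγ.image (ρ A c).continuous
  have hspec : ρ A c γ ⤳ ζ := himg.specializes hζt
  have hmem : ρ A c γ ∈ Z A c E := subset_closure ⟨γ, hγS, rfl⟩
  exact ⟨γ, hγS, hmax _ hmem hspec⟩

/-- **A swept-out maximal point of `Z` is `ρ ζ'` for a MAXIMAL point `ζ'` of `Supp 𝓔`**: among the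
finitely many `w ∈ Supp 𝓔` over `ζ` (finite fibres of the finite `ρ₁`) take one with maximal
closure. [folklore] -/
theorem exists_maximal_mem_suppSet {ζ : P A c} (hζ : ζ ∈ Z A c E)
    (hmax : ∀ z' ∈ Z A c E, z' ⤳ ζ → z' = ζ) :
    ∃ ζ' ∈ suppSet A c E, ρ A c ζ' = ζ ∧
      ∀ w ∈ suppSet A c E, w ⤳ ζ' → w = ζ' := by
  set T : Set (WA A c) := {w | w ∈ suppSet A c E ∧ ρ A c w = ζ} with hT
  have hTne : T.Nonempty := by
    obtain ⟨w, hw, hwζ⟩ := exists_mem_suppSet_of_maximal A c E hζ hmax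
    exact ⟨w, hw, hwζ⟩
  have hTfin : T.Finite := by
    have h1 : ((jA A c) ⁻¹' {ζ}).Finite :=
      (Set.subsingleton_singleton.preimage (jA A c).isOpenEmbedding.injective).finite
    have h2 : ((ρ₁ A c) ⁻¹' ((jA A c) ⁻¹' {ζ})).Finite :=
      h1.preimage' fun y _ => (ρ₁ A c).finite_preimage_singleton y
    refine h2.subset ?_
    rintro w ⟨-, hw⟩
    change jA A c (ρ₁ A c w) = ζ
    rw [← Scheme.Hom.comp_apply, ρ₁_jA, hw]
  obtain ⟨ζ', hζ'T, hζ'max⟩ :=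
    Set.Finite.exists_maximalFor (fun w => closure ({w} : Set (WA A c))) T hTfin hTne
  refine ⟨ζ', hζ'T.1, hζ'T.2, fun w hw hwζ' => ?_⟩
  have hwT : w ∈ T := by
    refine ⟨hw, hmax _ (subset_closure ⟨w, hw, rfl⟩) ?_⟩
    rw [← hζ'T.2]
    exact hwζ'.map (ρ A c).continuous
  have h1 : closure ({ζ'} : Set (WA A c)) ⊆ closure {w} := specializes_iff_closure_subset.1 hwζ'
  have h2 := hζ'max hwT h1
  have h3 : ζ' ⤳ w := specializes_iff_closure_subset.2 h2
  exact (hwζ'.antisymm h3).eq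

/-- **Purity of `Z`**: on an affine chart `V` of `P`, every minimal prime of the radical ideal
of `Z` has height one (Görtz–Wedhorn II, Thm. 27.71, Step (IV): the image of the effective Cartier
divisor `𝓔` under the finite flat `π × id` is a divisor; here: maximal points of `Z` are images of
maximal points of `Supp 𝓔`, where the local ring is one-dimensional, and flatness of `ρ` bounds the
height below). [cite: GortzWedhorn2023, Thm. 27.71, proof, Step (IV) (p. 829)] -/
theorem height_eq_one_of_mem_minimalPrimes (hE : E.IsEffective) (V : (P A c).Opens)
    (hV : IsAffineOpen V) [Nonempty V] (P₀ : Ideal Γ(P A c, V))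
    (hP₀ : P₀ ∈ ((Scheme.IdealSheafData.vanishingIdeal (Uo A c E).compl).ideal ⟨V, hV⟩).minimalPrimes) :
    P₀.height = 1 := by
  classical
  haveI : P₀.IsPrime := hP₀.1.1
  set J := (Scheme.IdealSheafData.vanishingIdeal (Uo A c E).compl).ideal ⟨V, hV⟩ with hJ
  -- the point `ζ` of `P₀`
  obtain ⟨zV, hzV⟩ : ∃ zV : V, hV.primeIdealOf zV = ⟨P₀, inferInstance⟩ :=
    ⟨⟨hV.fromSpec ⟨P₀, inferInstance⟩, FieldNorm.fromSpec_mem hV _⟩, FieldNorm.primeIdealOf_fromSpec hV _⟩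
  have hmemZ : ∀ y : V, J ≤ (hV.primeIdealOf y).asIdeal ↔ (y : P A c) ∈ Z A c E := fun y => by
    rw [hJ, vanishingIdeal_ideal_le_primeIdealOf_iff hV (Uo A c E).compl y, mem_Uo_compl_iff]
  have hζZ : (zV : P A c) ∈ Z A c E := (hmemZ zV).1 (by rw [hzV]; exact hP₀.1.2)
  -- `ζ` is a maximal point of `Z`
  have hζmax : ∀ z' ∈ Z A c E, z' ⤳ (zV : P A c) → z' = zV := by
    intro z' hz' hspec
    have hz'V : z' ∈ V := hspec.mem_open V.2 zV.2
    obtain ⟨y, rfl⟩ : ∃ y : V, (y : P A c) = z' := ⟨⟨z', hz'V⟩, rfl⟩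
    have hle : hV.primeIdealOf y ≤ hV.primeIdealOf zV :=
      (primeIdealOf_le_iff_specializes hV y zV).2 hspec
    have hJy : J ≤ (hV.primeIdealOf y).asIdeal := (hmemZ y).2 hz'
    have hge : P₀ ≤ (hV.primeIdealOf y).asIdeal := hP₀.2 ⟨inferInstance, hJy⟩ (by rw [hzV] at hle; exact hle)
    have heq : hV.primeIdealOf y = hV.primeIdealOf zV := by
      rw [hzV]; exact le_antisymm (by rw [hzV] at hle; exact hle) hge
    have := congrArg hV.fromSpec heq
    rw [hV.fromSpec_primeIdealOf, hV.fromSpec_primeIdealOf] at this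
    exact this
  -- a maximal point `ζ'` of `Supp 𝓔` over `ζ`
  obtain ⟨ζ', hζ'S, hζ'ρ, hζ'max⟩ := exists_maximal_mem_suppSet A c E hζZ hζmax
  have hdim : ringKrullDim ((WA A c).presheaf.stalk ζ') = 1 :=
    ringKrullDim_stalk_eq_one_of_maximal (incidence A c E) (hE.pullback _) hζ'S hζ'max
  -- an affine chart `V₃ ∋ ζ'` over `V` and the flat ring map
  have hζ'V : ζ' ∈ (ρ A c) ⁻¹ᵁ V := by
    change ρ A c ζ' ∈ V; rw [hζ'ρ]; exact zV.2
  obtain ⟨V₃, hV₃, hζ'V₃, hV₃le⟩ := exists_isAffineOpen_mem_and_subset hζ'V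
  obtain ⟨z₃, rfl⟩ : ∃ z₃ : V₃, (z₃ : WA A c) = ζ' := ⟨⟨ζ', hζ'V₃⟩, rfl⟩
  haveI : Nonempty V₃ := ⟨z₃⟩
  have hle₃ : V₃ ≤ (ρ A c) ⁻¹ᵁ V := hV₃le
  set φ := (ρ A c).appLE V V₃ hle₃ with hφ
  have hflat : φ.hom.Flat := HasRingHomProperty.appLE (P := @Flat) (ρ A c) inferInstance ⟨V, hV⟩ ⟨V₃, hV₃⟩ hle₃
  letI : Algebra Γ(P A c, V) Γ(WA A c, V₃) := φ.hom.toAlgebra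
  haveI : Module.Flat Γ(P A c, V) Γ(WA A c, V₃) := hflat
  haveI : IsNoetherianRing Γ(WA A c, V₃) := IsLocallyNoetherian.component_noetherian ⟨V₃, hV₃⟩
  haveI : IsNoetherianRing Γ(P A c, V) := IsLocallyNoetherian.component_noetherian ⟨V, hV⟩
  set 𝔔 := (hV₃.primeIdealOf z₃).asIdeal with h𝔔
  have hover : 𝔔.comap φ.hom = P₀ := by
    have h1 := IsAffineOpen.comap_primeIdealOf_appLE V hV V₃ hV₃ hle₃ z₃.2
    have h2 : hV.primeIdealOf ⟨ρ A c z₃, hle₃ z₃.2⟩ = hV.primeIdealOf zV := by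
      congr 1; exact Subtype.ext hζ'ρ
    rw [h2, hzV] at h1
    exact congrArg PrimeSpectrum.asIdeal h1
  haveI : 𝔔.LiesOver P₀ := ⟨hover.symm⟩
  -- heights: `ht 𝔔 = 1`, `ht P₀ ≤ ht 𝔔`
  have h𝔔 : 𝔔.height = 1 := by
    haveI := hV₃.isLocalization_stalk z₃
    have := IsLocalization.AtPrime.ringKrullDim_eq_height 𝔔 ((WA A c).presheaf.stalk z₃)
    rw [hdim] at this
    exact (WithBot.coe_eq_one.1 this.symm)
  have hle1 : P₀.height ≤ 1 := by
    have hformula := Ideal.height_eq_height_add_of_liesOver_of_hasGoingDown P₀ 𝔔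
    rw [h𝔔] at hformula
    exact hformula ▸ le_self_add
  -- `P₀ ≠ 0` since `η_P ∉ Z`
  have hne : P₀.height ≠ 0 := by
    intro h0
    rw [Ideal.height_eq_zero_iff] at h0
    have hbot : P₀ = ⊥ := le_bot_iff.1 (h0.2 ⟨Ideal.isPrime_bot, bot_le⟩ bot_le)
    apply genericPoint_notMem_Z A c E
    have h1 : hV.primeIdealOf zV = hV.primeIdealOf ⟨genericPoint (P A c),
        (genericPoint_spec (P A c)).mem_open_set_iff V.2 |>.2 ⟨_, Set.mem_univ _, zV.2⟩⟩ := by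
      rw [hzV, hV.primeIdealOf_genericPoint, genericPoint_eq_bot_of_affine]
      exact PrimeSpectrum.ext hbot
    have := congrArg hV.fromSpec h1
    rw [hV.fromSpec_primeIdealOf, hV.fromSpec_primeIdealOf] at this
    have h2 : (zV : P A c) = genericPoint (P A c) := this
    rw [← h2]
    exact hζZ
  exact le_antisymm hle1 (Order.one_le_iff_ne_zero.2 hne)

/-! ### The swept-out divisor -/

omit [IsAlgClosed k] in
/-- The local rings of `A` are factorial (regular: Auslander–Buchsbaum). [folklore] -/
theorem uniqueFactorizationMonoid_stalk_A (x : A.X.left) :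
    UniqueFactorizationMonoid (A.X.left.presheaf.stalk x) :=
  Resolution.Matsumura1987_20_3_holds _ (A.isRegularLocalRing_stalk x)

omit [IsAlgClosed k] in
/-- The local rings of `P = 𝔸ˢ_A` are factorial. [folklore] -/
theorem uniqueFactorizationMonoid_stalk_P (p : P A c) :
    UniqueFactorizationMonoid ((P A c).presheaf.stalk p) :=
  uniqueFactorizationMonoid_stalk_affineSpace _ (uniqueFactorizationMonoid_stalk_A A) p

/-- **The swept-out divisor** (Görtz–Wedhorn II, Thm. 27.71, Step (IV), "`𝓜`"): an effective
Cartier divisor `𝓓` on `P = 𝔸ˢ_A` whose support is exactly `Z`, the closure of `ρ(Supp act^*E)`.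
[cite: GortzWedhorn2023, Thm. 27.71, proof, Step (IV) (p. 829)] -/
theorem exists_sweptDivisor (hE : E.IsEffective) :
    ∃ 𝓓 : CartierDivisor (P A c), 𝓓.IsEffective ∧ ∀ p : P A c, 𝓓.Avoids p ↔ p ∉ Z A c E :=
  CartierDivisor.exists_isEffective_avoids_iff_of_pure (uniqueFactorizationMonoid_stalk_P A c)
    (Uo A c E) (fun V hV _ P₀ hP₀ => height_eq_one_of_mem_minimalPrimes A c E hE V hV P₀ hP₀)

end ChartFamily

end Literature.AlgebraicGeometry.Motives

end
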